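import Literature.NumberTheory.DiophantineApproximation.DilogHermitePade
import Mathlib.Analysis.Complex.LocallyUniformLimit
import Mathlib.Analysis.Normed.Group.FunctionSeries
import Mathlib.Analysis.PSeries
import HarnessLib

/-!
# The polylogarithm series as a holomorphic function of a complex variable

Topic `Literature/NumberTheory/DiophantineApproximation`. DEFINITION (`DilogPade.cpolylog`) with proved API; no
named facts.

`cpolylog s w = Σ_{k ≥ 0} w^{k+1}/(k+1)^s` is the complex companion of the tree's real `DilogPade.polylogSeries`
(`cpolylog_ofReal`). For `s = 2`: the terms are bounded by `1/(k+1)²` on the closed unit disc, so `cpolylog 2` is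
continuous on `‖w‖ ≤ 1` and holomorphic on `‖w‖ < 1` (Weierstrass), and `Z ↦ cpolylog 2 (1/Z)` is holomorphic on
`‖Z‖ > 1` and continuous on `‖Z‖ ≥ 1` — the analytic continuation in `Z` used for Viola–Zudilin's `J_{1−z}`
(VZ §2.2, Lemma 3.3).

## References

* C. Viola, W. Zudilin, J. reine angew. Math. 736 (2018) 193–223, §2.2. [ViolaZudilin2018]
-/

noncomputable section

namespace Literature.NumberTheory.DiophantineApproximation

namespace DilogPade

open Metric Complex

/-- The complex polylogarithm series `Σ_{k≥0} w^{k+1}/(k+1)^s`. [cite: ViolaZudilin2018, §1] -/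
def cpolylog (s : ℕ) (w : ℂ) : ℂ := ∑' k : ℕ, w ^ (k + 1) / ((k : ℂ) + 1) ^ s

/-- On real arguments `cpolylog` is the real `polylogSeries`. [folklore] -/
theorem cpolylog_ofReal (s : ℕ) (x : ℝ) : cpolylog s (x : ℂ) = (polylogSeries s x : ℂ) := by
  rw [cpolylog, polylogSeries, ofReal_tsum]
  refine tsum_congr fun k => ?_
  push_cast
  ring

/-- The terms of `cpolylog 2` are bounded by `1/(k+1)²` on the closed unit disc. [folklore] -/
theorem norm_term_two_le {w : ℂ} (hw : ‖w‖ ≤ 1) (k : ℕ) :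
    ‖w ^ (k + 1) / ((k : ℂ) + 1) ^ 2‖ ≤ 1 / ((k : ℝ) + 1) ^ 2 := by
  rw [norm_div, norm_pow, norm_pow, show ((k : ℂ) + 1) = ((k + 1 : ℕ) : ℂ) by push_cast; ring, norm_natCast]
  push_cast
  gcongr
  exact pow_le_one₀ (norm_nonneg _) hw

/-- `cpolylog 2` is continuous on the closed unit disc. [folklore] -/
theorem continuousOn_cpolylog_two : ContinuousOn (cpolylog 2) (closedBall 0 1) := by
  -- `Σ 1/(k+1)²` converges (also `GenusZeroPeriodsMZV.summable_one_div_nat_add_one_sq` in the tree; not imported here)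
  have hs : Summable fun k : ℕ => 1 / ((k : ℝ) + 1) ^ 2 := by
    simpa using (summable_nat_add_iff (f := fun k : ℕ => 1 / (k : ℝ) ^ 2) 1).2
      ((Real.summable_one_div_nat_pow (p := 2)).2 one_lt_two)
  refine continuousOn_tsum (fun k => ?_) hs fun k w hw => ?_
  · fun_prop
  · exact norm_term_two_le (by simpa using hw) k

/-- `cpolylog 2` is holomorphic on the open unit disc. [folklore] -/
theorem differentiableOn_cpolylog_two : DifferentiableOn ℂ (cpolylog 2) (ball 0 1) := by
  have hs : Summable fun k : ℕ => 1 / ((k : ℝ) + 1) ^ 2 := by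
    simpa using (summable_nat_add_iff (f := fun k : ℕ => 1 / (k : ℝ) ^ 2) 1).2
      ((Real.summable_one_div_nat_pow (p := 2)).2 one_lt_two)
  refine differentiableOn_tsum_of_summable_norm hs (fun k => ?_) isOpen_ball fun k w hw => ?_
  · fun_prop
  · exact norm_term_two_le (by simpa using (le_of_lt (mem_ball_zero_iff.1 hw))) k

/-- `Z ↦ Li₂(1/Z)` is holomorphic on `‖Z‖ > 1`. [cite: ViolaZudilin2018, §2.2] -/
theorem differentiableOn_cpolylog_two_inv : DifferentiableOn ℂ (fun Z : ℂ => cpolylog 2 (1 / Z)) {Z | 1 < ‖Z‖} := by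
  intro Z hZ
  have hZ0 : Z ≠ 0 := by rintro rfl; simp at hZ; linarith
  have hmem : 1 / Z ∈ ball (0 : ℂ) 1 := by
    rw [mem_ball_zero_iff, norm_div, norm_one, div_lt_one (by simpa using norm_pos_iff.2 hZ0)]; exact hZ
  exact ((differentiableOn_cpolylog_two _ hmem).differentiableAt (isOpen_ball.mem_nhds hmem)).comp_differentiableWithinAt _
    ((differentiableAt_const _).div differentiableAt_id hZ0).differentiableWithinAt

/-- `Z ↦ Li₂(1/Z)` is continuous on `‖Z‖ ≥ 1`. [cite: ViolaZudilin2018, §2.2] -/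
theorem continuousOn_cpolylog_two_inv : ContinuousOn (fun Z : ℂ => cpolylog 2 (1 / Z)) {Z | 1 ≤ ‖Z‖} := by
  refine continuousOn_cpolylog_two.comp (continuousOn_const.div continuousOn_id fun Z hZ => ?_) fun Z hZ => ?_
  · rintro rfl; simp at hZ; exact absurd hZ (by norm_num)
  · have hZ0 : Z ≠ 0 := by rintro rfl; simp at hZ; exact absurd hZ (by norm_num)
    rw [mem_closedBall_zero_iff, norm_div, norm_one, div_le_one (norm_pos_iff.2 hZ0)]
    exact hZ

end DilogPade

end Literature.NumberTheory.DiophantineApproximation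

end
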